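import Literature.Computability.AlgebraicComplexity.LaserValue
import Literature.Computability.AlgebraicComplexity.RectangularExponentLaserCertificate
import Literature.Computability.AlgebraicComplexity.AsymptoticRankMultiplesMatMul
import Literature.Barriers.MatrixMultiplication.UniversalMethodBarrierThm29
import Literature.Barriers.MatrixMultiplication.UniversalMethodBarrierCwCore
import HarnessLib

/-!
# From Le Gall values to laser-method degeneration certificates — proved

Topic `Literature/Computability/AlgebraicComplexity`.  The tree states the output of the laser
method in two shapes:

* **values** (`LaserValue.lean`, `HasLaserValue ρ t v`, i.e. `V_ρ(t) ≥ v`: some power `t^{⊗N}`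
  degenerates into a direct sum `⊕ᵢ ⟨kᵢ,mᵢ,nᵢ⟩` of matrix tensors of MIXED formats with
  `v^N ≲ ∑ᵢ (kᵢmᵢnᵢ)^{ρ/3}`) — the currency of Coppersmith–Winograd 1990 / Le Gall 2014, in which
  the tree proves `ω < 2.39, 2.376, 2.373` (`LaserMethodBigCW`, `BigCwSquareOmega`,
  `BigCwFourthOmega`);
* **degeneration certificates** (`RectangularExponentLaserCertificate.lean`,
  `CW5DegenerationCertificate T`: for every row `(κ, b)` of `T` and `δ > 0`, `t` independent copies
  of a power `CW_5^{⊗N}` degenerate into `V` independent copies of ONE matrix tensor `⟨a, B, a⟩`,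
  `a ≥ 2`, `a^κ ≤ B`, with `t · 7^N ≤ V · a^{b+δ}`) — the format of Vassilevska Williams–Xu–Xu–Zhou
  2024 / Alman–Duan–Vassilevska Williams–Xu–Xu–Zhou 2025, the trust base of the records
  `vxxz2024_omega_le` (`ω ≤ 2.371552`) and `advxxz2025_omega_le`
  (`RectangularExponentCertReduction.vxxz2024_omega_le_of_cw5Certificate`).

This file PROVES the passage from the first to the second for powers of `CW_5` (more generally for
any tensor below a power of a variable-symmetric tensor), by the classical argument of Schönhage's
`τ`-theorem / Alman 2021, Thm. 2.9 (proof): take a high power of the mixed direct sum, keep the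
dominant type class `F ⊙ ⟨A,B,C⟩` (`exists_typeClass`: it carries all of `(∑ᵢ (kᵢmᵢnᵢ)^{ρ/3})^N`
up to the polynomial factor `(N+1)^p`), and symmetrise with the two rotations of the degeneration
(available because `CW_q` is variable-symmetric, `IsVariableSymmetric.polyDegeneratesTo_rotate`)
into `F³ ⊙ ⟨ABC, ABC, ABC⟩`; the polynomial loss is absorbed by any margin `u < v`.

* `tensorRestrictsTo_matMulDirectSum_reindex`, `exists_positive_subfamily` — dropping the
  degenerate blocks (`kᵢmᵢnᵢ = 0`, allowed by `HasLaserValue`) is a restriction;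
* `exists_polyDegeneratesTo_multiple_cube` — **the cube extraction**: `t` variable-symmetric,
  `t^{⊗n} ⊵ ⊕ᵢ ⟨aᵢ,bᵢ,cᵢ⟩` (positive formats) ⇒ for every `N`,
  `t^{⊗3Nn} ⊵ F³ ⊙ ⟨M,M,M⟩` with `(∑ᵢ (aᵢbᵢcᵢ)^τ)^{3N} ≤ (N+1)^{3p} · F³ · M^{3τ}`;
* `exists_polyDegeneratesTo_cube_of_hasLaserValue` — **values give cubes**: `t` variable-symmetric,
  `t^{⊗c} ≥ T`, `V_ρ(T) ≥ v > u > 0` ⇒ some `t^{⊗cN} ⊵ F ⊙ ⟨M,M,M⟩` (`N, F, M ≥ 1`) with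
  `u^N ≤ F · M^ρ`;
* `cw5Certificate_of_hasLaserValue` — **values give certificates**: `CW_5^{⊗c} ≥ T` (`c ≥ 1`),
  `V_ρ(T) ≥ v > 7^c` (`ρ > 0`) ⇒ `CW5DegenerationCertificate [(1, ρ)]` (the matrices are `≥ 2`
  because `R̃(F ⊙ ⟨1,1,1⟩) = F ≤ R̃(CW_5)^{cN} = 7^{cN} < u^N`);
  `omegaRect_le_of_hasLaserValue` — hence `ω(1,1,1) ≤ ρ` over `ℂ` through the certificate pipeline
  (`omegaRect_le_of_cw5DegenerationCertificate`), the same conclusion as Le Gall's Thm. 2.2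
  (`omega_le_of_hasLaserValue`).

The instance at the tree's best classical analysis (`CW_5^{⊗4}`, `ρ = 2.37295`,
`BigCwFourthOmega.lean`) is `BigCwFourthCertificate.lean`: `CW5DegenerationCertificate [(1, 2.37295)]`,
a PROVED inhabitant of the certificate predicate.  Everything here is proved; no definitions, no
named facts.

## References

* J. Alman, *Limits on the Universal Method for matrix multiplication*, Theory of Computing 17
  (2021), proof of Thm. 2.9 ("since `T` is symmetric, `T^{⊗n}` also has a degeneration to
  `F ⊙ ⟨b,c,a⟩` and to `F ⊙ ⟨c,a,b⟩` … `F³ ⊙ ⟨abc,abc,abc⟩`"). [Alman2021]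
* M. Bläser, *Fast Matrix Multiplication*, Theory of Computing Graduate Surveys 5 (2013), proof of
  Thm. 7.5 (type classes of `(⊕ᵢ ⟨kᵢ,mᵢ,nᵢ⟩)^{⊗N}`), §9.4 (values). [Blaser2013]
* F. Le Gall, *Powers of tensors and fast matrix multiplication*, ISSAC 2014, arXiv:1401.7714,
  Def. 2.1, Thm. 2.2. [LeGall2014]
* J. Alman, R. Duan, V. Vassilevska Williams, Y. Xu, Z. Xu, R. Zhou, SODA 2025, §7 (procedure of
  degeneration: the certificate format). [AlmanDuanVassilevskaWilliamsXuXuZhou2025]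
-/

noncomputable section

open scoped BigOperators
open Finset

namespace Literature.Computability.AlgebraicComplexity

open Literature.Barriers.MatrixMultiplication

universe u

/-! ## Dropping degenerate blocks -/

section Reindex

variable (K : Type u) [CommSemiring K]

/-- **A sub-family of a direct sum of matrix tensors is a restriction of it** (zero out the other
blocks): for injective `f`, `⊕ᵢ ⟨kᵢ,mᵢ,nᵢ⟩ ≥ ⊕ⱼ ⟨k_{f j}, m_{f j}, n_{f j}⟩`. [cite: Blaser2013, Def. 7.2 and §7] -/
theorem tensorRestrictsTo_matMulDirectSum_reindex {p p' : ℕ} (k m n : Fin p → ℕ)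
    (f : Fin p' → Fin p) (hf : Function.Injective f) :
    TensorRestrictsTo (matMulDirectSum K k m n)
      (matMulDirectSum K (fun j => k (f j)) (fun j => m (f j)) (fun j => n (f j))) := by
  classical
  have key : matMulDirectSum K (fun j => k (f j)) (fun j => m (f j)) (fun j => n (f j)) =
      fun a b c => matMulDirectSum K k m n ⟨f a.1, a.2⟩ ⟨f b.1, b.2⟩ ⟨f c.1, c.2⟩ := by
    funext a b c
    simp only [matMulDirectSum, hf.eq_iff]
  rw [key]
  exact tensorRestrictsTo_precomp _ _ _ _

/-- **The blocks of positive volume**: an injective enumeration `f` of `{i | kᵢmᵢnᵢ > 0}`; the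
`τ`-volume sum (`τ ≠ 0`) is unchanged, since the dropped blocks contribute `0^τ = 0`. [folklore] -/
theorem exists_positive_subfamily {p : ℕ} (k m n : Fin p → ℕ) {τ : ℝ} (hτ : τ ≠ 0) :
    ∃ (p' : ℕ) (f : Fin p' → Fin p), Function.Injective f ∧
      (∀ j, 0 < k (f j) ∧ 0 < m (f j) ∧ 0 < n (f j)) ∧
      ∑ j, ((k (f j) * m (f j) * n (f j) : ℕ) : ℝ) ^ τ = ∑ i, ((k i * m i * n i : ℕ) : ℝ) ^ τ := by
  classical
  obtain ⟨s, hs⟩ : ∃ s : Finset (Fin p), s = Finset.univ.filter fun i => 0 < k i * m i * n i :=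
    ⟨_, rfl⟩
  have hs' : ∀ i, i ∈ s ↔ 0 < k i * m i * n i := fun i => by rw [hs]; simp
  set e := s.equivFin with he
  refine ⟨s.card, fun j => (e.symm j).1, ?_, ?_, ?_⟩
  · intro j j' hjj'
    exact e.symm.injective (Subtype.ext hjj')
  · intro j
    have h : 0 < k (e.symm j).1 * m (e.symm j).1 * n (e.symm j).1 := (hs' _).1 (e.symm j).2
    refine ⟨Nat.pos_of_ne_zero fun h0 => ?_, Nat.pos_of_ne_zero fun h0 => ?_,
      Nat.pos_of_ne_zero fun h0 => ?_⟩ <;> simp [h0] at h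
  · set g : Fin p → ℝ := fun i => ((k i * m i * n i : ℕ) : ℝ) ^ τ with hg
    have h1 : ∑ j, g (e.symm j).1 = ∑ x : s, g x.1 := Equiv.sum_comp e.symm (fun x : s => g x.1)
    have h2 : ∑ x : s, g x.1 = ∑ i ∈ s, g i := Finset.sum_coe_sort s g
    have h3 : ∑ i ∈ s, g i = ∑ i, g i := by
      refine Finset.sum_subset (Finset.subset_univ _) fun i _ hi => ?_
      have h0 : k i * m i * n i = 0 := Nat.eq_zero_of_not_pos fun h => hi ((hs' i).2 h)
      simp only [hg, h0, Nat.cast_zero, Real.zero_rpow hτ]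
    simpa only [hg] using h1.trans (h2.trans h3)

end Reindex

/-! ## Cube extraction from a mixed direct sum (Alman 2021, proof of Thm. 2.9) -/

section Cube

variable (K : Type u) [Field K] {ι : Type*} [Fintype ι] [DecidableEq ι]

/-- **Cube extraction** (the mechanism of Schönhage's `τ`-theorem in Alman's degeneration setting,
proof of Thm. 2.9): for a variable-symmetric `t` with `t^{⊗n} ⊵ ⊕ᵢ ⟨aᵢ,bᵢ,cᵢ⟩` (positive
formats) and every `N`, some type class `F ⊙ ⟨A,B,C⟩ ≤ (⊕ᵢ …)^{⊗N}` and its two rotations give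
`t^{⊗3Nn} ⊵ F³ ⊙ ⟨M,M,M⟩`, `M = ABC ≥ 1`, with
`(∑ᵢ (aᵢbᵢcᵢ)^τ)^{3N} ≤ (N+1)^{3p} · F³ · M^{3τ}`. [cite: Alman2021, Thm. 2.9 (proof)] -/
theorem exists_polyDegeneratesTo_multiple_cube {t : ι → ι → ι → K} (ht : IsVariableSymmetric t)
    {n p : ℕ} {a b c : Fin p → ℕ} (hpos : ∀ i, 0 < a i ∧ 0 < b i ∧ 0 < c i)
    (hdeg : PolyDegeneratesTo (kroneckerPow t n) (matMulDirectSum K a b c)) (τ : ℝ)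
    (N : ℕ) :
    ∃ F M : ℕ, 1 ≤ M ∧
      PolyDegeneratesTo (kroneckerPow t (3 * (N * n)))
        (kroneckerTensor (unitTensor K (F ^ 3)) (matMulTensor K M M M)) ∧
      (∑ i, ((a i * b i * c i : ℕ) : ℝ) ^ τ) ^ (3 * N) ≤
        ((N : ℝ) + 1) ^ (3 * p) * ((((F ^ 3 : ℕ) : ℝ)) * (M : ℝ) ^ (3 * τ)) := by
  obtain ⟨F, A, B, C, hA, hB, hC, hres, hineq⟩ := exists_typeClass K a b c τ N hpos
  -- `t^{⊗Nn} ⊵ F ⊙ ⟨A,B,C⟩` and its two rotations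
  have h₁ : PolyDegeneratesTo (kroneckerPow t (N * n))
      (kroneckerTensor (unitTensor K F) (matMulTensor K A B C)) :=
    (tensorRestrictsTo_kroneckerPow_mul t N n).trans_polyDegeneratesTo
      ((hdeg.kroneckerPow N).trans_restrictsTo hres)
  have ht₁ := ht.kroneckerPow (N * n)
  have h₂ : PolyDegeneratesTo (kroneckerPow t (N * n))
      (kroneckerTensor (unitTensor K F) (matMulTensor K B C A)) :=
    (ht₁.polyDegeneratesTo_rotate h₁).trans_restrictsTo
      (tensorRestrictsTo_rotate_multiple_matMulTensor K F A B C)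
  have h₃ : PolyDegeneratesTo (kroneckerPow t (N * n))
      (kroneckerTensor (unitTensor K F) (matMulTensor K C A B)) :=
    (ht₁.polyDegeneratesTo_rotate h₂).trans_restrictsTo
      (tensorRestrictsTo_rotate_multiple_matMulTensor K F B C A)
  -- `t^{⊗3Nn} ⊵ F³ ⊙ ⟨ABC, ABC, ABC⟩`
  refine ⟨F, A * B * C, Nat.mul_pos (Nat.mul_pos hA hB) hC, ?_, ?_⟩
  · have s0 : TensorRestrictsTo (kroneckerPow t (3 * (N * n)))
        (kroneckerPow t (N * n + (N * n + N * n))) :=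
      tensorRestrictsTo_kroneckerPow_of_eq t (by ring)
    have s1 : TensorRestrictsTo (kroneckerPow t (N * n + (N * n + N * n)))
        (kroneckerTensor (kroneckerPow t (N * n))
          (kroneckerTensor (kroneckerPow t (N * n)) (kroneckerPow t (N * n)))) :=
      (tensorRestrictsTo_kroneckerPow_add t _ _).trans
        ((TensorRestrictsTo.refl _).kronecker (tensorRestrictsTo_kroneckerPow_add t _ _))
    have s2 := (s0.trans s1).trans_polyDegeneratesTo (h₁.kronecker (h₂.kronecker h₃))
    have s3 : TensorRestrictsTo
        (kroneckerTensor (kroneckerTensor (unitTensor K F) (matMulTensor K A B C))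
          (kroneckerTensor (kroneckerTensor (unitTensor K F) (matMulTensor K B C A))
            (kroneckerTensor (unitTensor K F) (matMulTensor K C A B))))
        (kroneckerTensor (unitTensor K (F * (F * F)))
          (matMulTensor K (A * (B * C)) (B * (C * A)) (C * (A * B)))) :=
      ((TensorRestrictsTo.refl _).kronecker
        (tensorRestrictsTo_kronecker_multiple_matMulTensor K F B C A F C A B)).trans
        (tensorRestrictsTo_kronecker_multiple_matMulTensor K F A B C (F * F) (B * C) (C * A) (A * B))
    have s4 : TensorRestrictsTo
        (kroneckerTensor (unitTensor K (F * (F * F)))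
          (matMulTensor K (A * (B * C)) (B * (C * A)) (C * (A * B))))
        (kroneckerTensor (unitTensor K (F ^ 3)) (matMulTensor K (A * B * C) (A * B * C) (A * B * C))) :=
      tensorRestrictsTo_multiple_matMulTensor_of_eq K (by ring) (by ring) (by ring) (by ring)
    exact (s2.trans_restrictsTo s3).trans_restrictsTo s4
  · -- `(S^N)^3 ≤ ((N+1)^p · F · M^τ)^3 = (N+1)^{3p} · F³ · M^{3τ}`
    have hS0 : 0 ≤ ∑ i, ((a i * b i * c i : ℕ) : ℝ) ^ τ :=
      Finset.sum_nonneg fun i _ => Real.rpow_nonneg (Nat.cast_nonneg _) _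
    have hM0 : (0 : ℝ) ≤ ((A * B * C : ℕ) : ℝ) := Nat.cast_nonneg _
    have e1 : (∑ i, ((a i * b i * c i : ℕ) : ℝ) ^ τ) ^ (3 * N) =
        ((∑ i, ((a i * b i * c i : ℕ) : ℝ) ^ τ) ^ N) ^ 3 := by rw [mul_comm, pow_mul]
    have e3 : ((A * B * C : ℕ) : ℝ) ^ (3 * τ) = (((A * B * C : ℕ) : ℝ) ^ τ) ^ 3 := by
      rw [show (3 : ℝ) * τ = τ * ((3 : ℕ) : ℝ) by push_cast; ring, Real.rpow_mul_natCast hM0]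
    have e2 : ((N : ℝ) + 1) ^ (3 * p) * ((((F ^ 3 : ℕ) : ℝ)) * ((A * B * C : ℕ) : ℝ) ^ (3 * τ)) =
        (((N : ℝ) + 1) ^ p * ((F : ℝ) * ((A * B * C : ℕ) : ℝ) ^ τ)) ^ 3 := by
      rw [e3]; push_cast; ring
    rw [e1, e2]
    exact pow_le_pow_left₀ (pow_nonneg hS0 N) hineq 3

end Cube

/-! ## Values give cubes, cubes give certificates -/

section Values

variable {K : Type u} [Field K] {ι : Type*} [Fintype ι] [DecidableEq ι]

/-- **Values give cubes**: if `t` is variable-symmetric, `t^{⊗c} ≥ T` and `V_ρ(T) ≥ v`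
(`HasLaserValue ρ T v`, `ρ > 0`), then for every `0 < u < v` some power `t^{⊗cN}` (`N ≥ 1`)
degenerates into `F ⊙ ⟨M,M,M⟩` (`F, M ≥ 1`) with `u^N ≤ F · M^ρ`: the mixed direct sum of a
witness at precision `ε` with `(1+ε)u < v` is cubed by `exists_polyDegeneratesTo_multiple_cube`, and
the loss `(N'+1)^{3p}` is beaten by `(v/((1+ε)u))^{3N'n}` for `N'` large.
[cite: Alman2021, Thm. 2.9 (proof)] [cite: Blaser2013, §9.4] -/
theorem exists_polyDegeneratesTo_cube_of_hasLaserValue {ι' κ' μ' : Type*} [Fintype ι'] [Fintype κ']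
    [Fintype μ'] {t : ι → ι → ι → K} (ht : IsVariableSymmetric t)
    {c : ℕ} {T : ι' → κ' → μ' → K} (hT : TensorRestrictsTo (kroneckerPow t c) T)
    {ρ v : ℝ} (hρ : 0 < ρ) (h : HasLaserValue ρ T v) {u : ℝ} (hu : 0 < u) (huv : u < v) :
    ∃ N F M : ℕ, 1 ≤ N ∧ 1 ≤ F ∧ 1 ≤ M ∧
      PolyDegeneratesTo (kroneckerPow t (c * N))
        (kroneckerTensor (unitTensor K F) (matMulTensor K M M M)) ∧
      u ^ N ≤ (F : ℝ) * (M : ℝ) ^ ρ := by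
  classical
  have hv : 0 < v := hu.trans huv
  -- precision `ε` with `(1 + ε) u < v`
  set ε : ℝ := (v - u) / (2 * u) with hε
  have hε0 : 0 < ε := by rw [hε]; exact div_pos (by linarith) (by linarith)
  have hne : (2 : ℝ) * u ≠ 0 := by positivity
  have hεu' : (1 + ε) * u = (u + v) / 2 := by rw [hε]; field_simp; ring
  have hεu : (1 + ε) * u < v := by rw [hεu']; linarith
  have hne' : (1 + ε) * u ≠ 0 := by positivity
  obtain ⟨n, hn, p, k, m, l, hdeg, hb⟩ := h ε hε0
  -- drop the degenerate blocks
  obtain ⟨p', f, hf, hpos, hsum⟩ := exists_positive_subfamily k m l (τ := ρ / 3) (by positivity)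
  have hdeg' : PolyDegeneratesTo (kroneckerPow t (n * c))
      (matMulDirectSum K (fun j => k (f j)) (fun j => m (f j)) (fun j => l (f j))) :=
    ((tensorRestrictsTo_kroneckerPow_mul t n c).trans_polyDegeneratesTo
      ((hT.polyDegeneratesTo.kroneckerPow n).trans hdeg)).trans_restrictsTo
      (tensorRestrictsTo_matMulDirectSum_reindex K k m l f hf)
  set S : ℝ := ∑ j, ((k (f j) * m (f j) * l (f j) : ℕ) : ℝ) ^ (ρ / 3) with hS
  have hSv : v ^ n ≤ (1 + ε) ^ n * S := by
    have hb' := hb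
    rw [← hsum] at hb'
    exact hb'
  -- the ratio `γ = v / ((1+ε) u) > 1` beats the polynomial loss
  set γ : ℝ := v / ((1 + ε) * u) with hγ
  have hγ1 : 1 < γ := by rw [hγ, one_lt_div (by positivity)]; exact hεu
  have hS1 : ((1 + ε) * u * γ) ^ n ≤ (1 + ε) ^ n * S := by
    have : (1 + ε) * u * γ = v := by rw [hγ]; field_simp
    rw [this]; exact hSv
  have hSγ : (u * γ) ^ n ≤ S := by
    have h1 : ((1 + ε) * u * γ) ^ n = (1 + ε) ^ n * (u * γ) ^ n := by rw [← mul_pow]; ring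
    rw [h1] at hS1
    exact le_of_mul_le_mul_left hS1 (by positivity)
  -- choose `N'` with `(N'+1)^{3p'} ≤ γ^{3 N' n}` … via `(N'+1)^{p'} ≤ (γ^n)^{N'}`
  have hγn : 1 < γ ^ n := one_lt_pow₀ hγ1 (by omega)
  obtain ⟨N', hN'1, hN'⟩ : ∃ N' : ℕ, 1 ≤ N' ∧ ((N' : ℝ) + 1) ^ p' ≤ (γ ^ n) ^ N' := by
    -- `(x+1)^p / (γ^n)^x → 0`
    have hlim : Filter.Tendsto (fun x : ℕ => ((x : ℝ) + 1) ^ p' / (γ ^ n) ^ x) Filter.atTop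
        (nhds 0) := by
      have h0 := tendsto_pow_const_div_const_pow_of_one_lt p' hγn
      -- shift by one: `((x+1)^p / γ^{n(x+1)}) · γ^n`
      have h1 : Filter.Tendsto (fun x : ℕ => ((((x + 1 : ℕ) : ℝ)) ^ p' / (γ ^ n) ^ (x + 1)) * γ ^ n)
          Filter.atTop (nhds (0 * γ ^ n)) :=
        ((h0.comp (Filter.tendsto_add_atTop_nat 1)).mul_const _)
      rw [zero_mul] at h1
      refine h1.congr fun x => ?_
      have hγ0 : (γ ^ n) ≠ 0 := by positivity
      push_cast
      rw [pow_succ]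
      field_simp
    have hev := (hlim.eventually (gt_mem_nhds (show (0 : ℝ) < 1 by norm_num)))
    rw [Filter.eventually_atTop] at hev
    obtain ⟨N₀, hN₀⟩ := hev
    refine ⟨max N₀ 1, le_max_right _ _, ?_⟩
    have h := hN₀ (max N₀ 1) (le_max_left _ _)
    rw [div_lt_one (by positivity)] at h
    exact h.le
  -- cube extraction at `N'`
  obtain ⟨F, M, hM, hcube, hineq⟩ := exists_polyDegeneratesTo_multiple_cube K ht hpos hdeg'
    (ρ / 3) N'
  have hρ3 : 3 * (ρ / 3) = ρ := by ring
  rw [hρ3] at hineq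
  -- the numerical chain: `u^{3N'n} ≤ F³ M^ρ`
  have hM1 : (1 : ℝ) ≤ M := by exact_mod_cast hM
  have hchain : (u ^ (3 * (N' * n)) : ℝ) ≤ ((F ^ 3 : ℕ) : ℝ) * (M : ℝ) ^ ρ := by
    have h1 : (u ^ (3 * (N' * n)) : ℝ) * ((N' : ℝ) + 1) ^ (3 * p') ≤ S ^ (3 * N') := by
      have e1 : S ^ (3 * N') = (S ^ N') ^ 3 := by rw [mul_comm, pow_mul]
      have e2 : (u ^ (3 * (N' * n)) : ℝ) * ((N' : ℝ) + 1) ^ (3 * p') =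
          ((u ^ n) ^ N' * ((N' : ℝ) + 1) ^ p') ^ 3 := by
        ring
      rw [e1, e2]
      refine pow_le_pow_left₀ (by positivity) ?_ 3
      calc (u ^ n) ^ N' * ((N' : ℝ) + 1) ^ p' ≤ (u ^ n) ^ N' * (γ ^ n) ^ N' :=
            mul_le_mul_of_nonneg_left hN' (by positivity)
        _ = ((u * γ) ^ n) ^ N' := by rw [← mul_pow, ← mul_pow]
        _ ≤ S ^ N' := pow_le_pow_left₀ (by positivity) hSγ N'
    have h2 : S ^ (3 * N') ≤ ((N' : ℝ) + 1) ^ (3 * p') * (((F ^ 3 : ℕ) : ℝ) * (M : ℝ) ^ ρ) := hineq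
    have hpoly : (0 : ℝ) < ((N' : ℝ) + 1) ^ (3 * p') := by positivity
    have h3 : u ^ (3 * (N' * n)) * ((N' : ℝ) + 1) ^ (3 * p') ≤
        (((F ^ 3 : ℕ) : ℝ) * (M : ℝ) ^ ρ) * ((N' : ℝ) + 1) ^ (3 * p') :=
      (h1.trans h2).trans_eq (mul_comm _ _)
    exact le_of_mul_le_mul_right h3 hpoly
  have hF : 1 ≤ F := by
    by_contra hF0
    have hF0' : F = 0 := by omega
    have hpos' : (0 : ℝ) < u ^ (3 * (N' * n)) := by positivity
    rw [hF0'] at hchain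
    norm_num at hchain
    linarith
  refine ⟨3 * (N' * n), F ^ 3, M, ?_, Nat.one_le_pow _ _ hF, hM, ?_, ?_⟩
  · have := Nat.mul_pos (by omega : 0 < N') (by omega : 0 < n); omega
  · have e : c * (3 * (N' * n)) = 3 * (N' * (n * c)) := by ring
    exact (tensorRestrictsTo_kroneckerPow_of_eq t e).trans_polyDegeneratesTo hcube
  · exact_mod_cast hchain

/-- **Values give degeneration certificates on `CW_5`**: if `CW_5^{⊗c} ≥ T` (`c ≥ 1`) and
`V_ρ(T) ≥ v > 7^c = R̃(CW_5)^c` (`ρ > 0`), then `CW5DegenerationCertificate [(1, ρ)]`: for every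
`δ > 0` one copy of a power `CW_5^{⊗N}` degenerates into `V` copies of `⟨a,a,a⟩`, `a ≥ 2`, with
`7^N ≤ V a^ρ ≤ V a^{ρ+δ}`.  (`a ≥ 2` because `a = 1` would give
`V = R̃(V ⊙ ⟨1,1,1⟩) ≤ R̃(CW_5^{⊗N}) ≤ 7^N < u^{N/c} ≤ V`.)  With the certificate pipeline this is
Le Gall's Thm. 2.2 in certificate form. [cite: LeGall2014, Thm. 2.2] [cite: AlmanDuanVassilevskaWilliamsXuXuZhou2025, §7 (procedure of degeneration)] -/
theorem cw5Certificate_of_hasLaserValue {ι' κ' μ' : Type} [Fintype ι'] [Fintype κ'] [Fintype μ']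
    [DecidableEq ι'] [DecidableEq κ'] [DecidableEq μ'] {c : ℕ} (hc : 1 ≤ c)
    {T : ι' → κ' → μ' → ℂ} (hT : TensorRestrictsTo (kroneckerPow (bigCwTensor ℂ 5) c) T)
    {ρ v : ℝ} (hρ : 0 < ρ) (h : HasLaserValue ρ T v) (h7 : (7 : ℝ) ^ c < v) :
    CW5DegenerationCertificate [((1 : ℝ), ρ)] := by
  classical
  intro k b hkb δ hδ
  obtain ⟨hk1, hbρ⟩ : k = 1 ∧ b = ρ := by simpa using hkb
  subst hk1
  subst b
  -- a margin `7^c < u < v`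
  set u : ℝ := ((7 : ℝ) ^ c + v) / 2 with hu
  have h7u : (7 : ℝ) ^ c < u := by rw [hu]; linarith
  have huv : u < v := by rw [hu]; linarith
  have hu0 : 0 < u := lt_trans (by positivity) h7u
  obtain ⟨N, F, M, hN, hF, hM, hdeg, hineq⟩ :=
    exists_polyDegeneratesTo_cube_of_hasLaserValue (isVariableSymmetric_bigCwTensor 5) hT hρ h hu0 huv
  have hcN : 1 ≤ c * N := Nat.mul_pos hc hN
  -- `R̃(CW_5^{⊗cN}) ≤ 7^{cN} < u^N`
  have hR : asymptoticRank (kroneckerPow (bigCwTensor ℂ 5) (c * N)) ≤ (7 : ℝ) ^ (c * N) := by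
    refine (asymptoticRank_kroneckerPow_le _ hcN).trans ?_
    have h7 : asymptoticRank (bigCwTensor ℂ 5) ≤ 7 := by
      have := asymptoticRank_bigCwTensor_le ℂ 5; norm_num at this; exact this
    exact pow_le_pow_left₀ (asymptoticRank_nonneg _) h7 _
  have h7N : (7 : ℝ) ^ (c * N) < u ^ N := by
    rw [pow_mul]; exact pow_lt_pow_left₀ h7u (by positivity) (by omega)
  -- hence `M ≥ 2`
  have hM2 : 2 ≤ M := by
    by_contra hlt
    have hM1 : M = 1 := by omega
    subst hM1
    have hRF : asymptoticRank (kroneckerTensor (unitTensor ℂ F) (matMulTensor ℂ 1 1 1)) = F := by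
      rw [asymptoticRank_multiple_matMulTensor_cube ℂ le_rfl hF]; simp
    have h1 := (asymptoticRank_le_of_polyDegeneratesTo hdeg).trans hR
    rw [hRF] at h1
    have h2 : u ^ N ≤ (F : ℝ) := by simpa using hineq
    linarith
  have hM1 : (1 : ℝ) ≤ M := by exact_mod_cast hM
  -- `⟨1⟩ ⊗ CW^{⊗cN} ≥ CW^{⊗cN} ⊵ F ⊙ ⟨M,M,M⟩`
  have hone : TensorRestrictsTo
      (kroneckerTensor (unitTensor ℂ 1) (kroneckerPow (bigCwTensor ℂ 5) (c * N)))
      (kroneckerPow (bigCwTensor ℂ 5) (c * N)) := by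
    convert tensorRestrictsTo_precomp
      (kroneckerTensor (unitTensor ℂ 1) (kroneckerPow (bigCwTensor ℂ 5) (c * N)))
      (fun x : Fin (c * N) → Fin (5 + 2) => ((0 : Fin 1), x))
      (fun y : Fin (c * N) → Fin (5 + 2) => ((0 : Fin 1), y))
      (fun z : Fin (c * N) → Fin (5 + 2) => ((0 : Fin 1), z)) using 1
    funext x y z
    rw [kroneckerTensor_apply, unitTensor_apply, if_pos ⟨rfl, rfl⟩, one_mul]
  have hdeg1 : PolyDegeneratesTo
      (kroneckerTensor (unitTensor ℂ 1) (kroneckerPow (bigCwTensor ℂ 5) (c * N)))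
      (kroneckerTensor (unitTensor ℂ F) (matMulTensor ℂ M M M)) :=
    hone.polyDegeneratesTo.trans hdeg
  -- `1 · 7^{cN} ≤ u^N ≤ F M^ρ ≤ F M^{ρ+δ}`
  have hmono : (M : ℝ) ^ ρ ≤ (M : ℝ) ^ (ρ + δ) :=
    Real.rpow_le_rpow_of_exponent_le hM1 (by linarith)
  have hF0 : (0 : ℝ) ≤ F := Nat.cast_nonneg _
  have hnum : ((1 : ℕ) : ℝ) * 7 ^ (c * N) ≤ (F : ℝ) * (M : ℝ) ^ (ρ + δ) := by
    rw [Nat.cast_one, one_mul]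
    exact (h7N.le.trans hineq).trans (mul_le_mul_of_nonneg_left hmono hF0)
  have hk : ((M : ℝ)) ^ (1 : ℝ) ≤ (M : ℕ) := by rw [Real.rpow_one]
  exact ⟨c * N, 1, F, M, M, hcN, le_rfl, hF, hM2, hk, hdeg1, hnum⟩

/-- **`ω(1,1,1) ≤ ρ` from a value, through the certificate pipeline** (`= ω(ℂ) ≤ ρ`, Le Gall's
Thm. 2.2, here recovered from `cw5Certificate_of_hasLaserValue` and the fleet's
`omegaRect_le_of_cw5DegenerationCertificate`). [cite: LeGall2014, Thm. 2.2] -/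
theorem omegaRect_le_of_hasLaserValue {ι' κ' μ' : Type} [Fintype ι'] [Fintype κ'] [Fintype μ']
    [DecidableEq ι'] [DecidableEq κ'] [DecidableEq μ'] {c : ℕ} (hc : 1 ≤ c)
    {T : ι' → κ' → μ' → ℂ} (hT : TensorRestrictsTo (kroneckerPow (bigCwTensor ℂ 5) c) T)
    {ρ v : ℝ} (hρ : 0 < ρ) (h : HasLaserValue ρ T v) (h7 : (7 : ℝ) ^ c < v) :
    omegaRect ℂ 1 1 1 ≤ ρ :=
  omegaRect_le_of_cw5DegenerationCertificate (cw5Certificate_of_hasLaserValue hc hT hρ h h7)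
    (List.mem_singleton.2 rfl) zero_le_one

end Values

end Literature.Computability.AlgebraicComplexity
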